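import Summits.BirchSwinnertonDyer.BirchSwinnertonDyer.Theorems.Rank2Observatory2DescKillList
import Literature.NumberTheory.AdelicBaseChange.PadicTensorCompletionProofs
import Literature.NumberTheory.NumberFields.CubicFieldExplicit
import Mathlib.NumberTheory.Padics.RingHoms
import Mathlib.RingTheory.TensorProduct.Free
import HarnessLib

/-!
# BirchSwinnertonDyer — SEL2CUBIC kill layer, local half: a `p`-ADIC zero of the quadric pair of a
# `2`-descent class from per-place square data, and its INTEGER shadows mod `p^N`

HONEST FRAMING: route `ShaPrimaryTransfer`, seat `bsd-line-spt-p1` (g30), `--supports` item T =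
`FiniteShaComponentTransfer` (stmt-22356), UNCHANGED (conjecture-grade at corank ≥ 2). BSD in rank ≥ 2 is NOT
proved by any of this. THEOREMS ONLY.

The kill layer of the kernel `2`-descent (`Rank2Observatory2DescKill*`) certifies that the quadric pair
`killQ = (Q₁, Q₂)` of a class `z = z₀ + z₁α + z₂α²` (cubic field `K = ℚ(α)`, `θ = t₀ + t₁α + t₂α²` the
`2`-division root) has no INTEGER zero primitive at a prime `p` (`TwoDescKill.KillValidAt`) — enough to exclude
`(x − θ)·z ∈ K²` for RATIONAL `x` (`not_isSquare_of_killValidAt`), but silent about `2`-SELMER classes, whose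
`2`-coverings have points everywhere locally and in general no rational point. What every certificate shape
(`killCheck`, `sig3Check`, `sig12uCheck`, …) actually establishes is the STRONGER residue statement «no
`p`-primitive integer vector `v` with `p^N ∣ Q₁(v), Q₂(v)`», and what a `2`-Selmer class supplies at `p` is a
`p`-ADIC zero. This file is the bridge between the two currencies, in three steps:

* `exists_primitive_killQ_dvd_of_padic_zero` — a non-zero zero of `killQ` in `ℚ_[p]⁴` gives, for every `N`,
  an integer vector primitive at `p` with `p^N ∣ Q₁, Q₂` (rescale to a primitive `ℤ_p`-vector, reduce mod
  `p^N`, lift to `ℤ`);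
* `killQ_eq_zero_of_tmul_sq` — in the semi-local algebra `ℚ_[p] ⊗_ℚ K` (basis `1 ⊗ αⁱ`), a solution `ρ` of
  `(1 ⊗ z)·ρ² = x ⊗ 1 − 1 ⊗ θ` with `x ∈ ℚ_[p]` has coordinates `(c₀, c₁, c₂)` with `killQ (c₀, c₁, c₂, 1) = 0`
  (comparison of the `α`, `α²` coordinates; the ring identity `ev_zsq`);
* `exists_tmul_sq_of_forall_extension` — such a `ρ` exists as soon as, at EVERY place `w ∣ p` of `K`,
  `z·ρ_w² = x − θ` is solvable in `K_w` for one and the same `x ∈ ℚ_p`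
  (`ℚ_[p] ⊗_ℚ K ≅ ∏_{w ∣ p} K_w`, the tree's `exists_padicTensorAlgEquiv`, Cassels–Fröhlich II §10);
* `exists_primitive_killQ_dvd_of_forall_extension` — the composite.

The remaining (global) half — a `2`-Selmer class `c` with Cassels class `[a]`, `a·z ∈ K²`, supplies at every
`p` ONE point `P ∈ E(ℚ_p)` with `[a]_w = [x(P) − θ]_w` at every `w ∣ p` — is the local Kummer theory of
`TwoDescentOneRootKummerBridgeLocal` read uniformly in `w`; it is NOT in this file.
[cite: Cassels1991LecturesEllipticCurves, §15] [cite: CremonaAlgorithms1997, §3.6]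
[cite: CasselsFrohlichANT1967, Ch. II §10 Theorem (10.2)]
-/

-- single-conjunct summit: `Summit.BirchSwinnertonDyer.BirchSwinnertonDyer.…` repeats the name by design
set_option linter.dupNamespace false

noncomputable section

open scoped TensorProduct NumberField

namespace Summit.BirchSwinnertonDyer.BirchSwinnertonDyer.Theorems.ShaPrimaryTransferSelmerCubicKill

open Summit.BirchSwinnertonDyer.BirchSwinnertonDyer.Rank2Observatory
open Summit.BirchSwinnertonDyer.BirchSwinnertonDyer.Rank2Observatory.TwoDescKill
open Summit.BirchSwinnertonDyer.BirchSwinnertonDyer.Rank2Observatory.TwoDescCubic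

/-! ## Step 1: from a `p`-adic zero to integer vectors primitive at `p`, modulo `p^N` -/

section Padic

variable {p : ℕ} [Fact p.Prime]

/-- Rescaling a non-zero vector of `ℚ_[p]⁴` to a primitive vector of `ℤ_[p]⁴`: dividing by a coordinate of
maximal norm makes every coordinate integral and that coordinate `1`. [folklore] -/
theorem exists_scale_primitive (u : Fin 4 → ℚ_[p]) (hu : ∃ j, u j ≠ 0) :
    ∃ s : ℚ_[p], s ≠ 0 ∧ (∀ j, ‖s * u j‖ ≤ 1) ∧ ∃ j, ‖s * u j‖ = 1 := by
  obtain ⟨j₀, -, hmax⟩ := Finset.exists_max_image Finset.univ (fun j => ‖u j‖) Finset.univ_nonempty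
  obtain ⟨j₁, hj₁⟩ := hu
  have h0 : u j₀ ≠ 0 := by
    intro h
    have h1 := hmax j₁ (Finset.mem_univ _)
    rw [h, norm_zero] at h1
    exact hj₁ (norm_le_zero_iff.mp h1)
  have hpos : 0 < ‖u j₀‖ := norm_pos_iff.mpr h0
  refine ⟨(u j₀)⁻¹, inv_ne_zero h0, fun j => ?_, ⟨j₀, ?_⟩⟩
  · rw [norm_mul, norm_inv, inv_mul_le_iff₀ hpos, mul_one]
    exact hmax j (Finset.mem_univ _)
  · rw [inv_mul_cancel₀ h0, norm_one]

/-- `killQ` read through a ring map on congruent arguments: if `f vⱼ = f wⱼ` for all four coordinates then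
`f (killQ v) = f (killQ w)` (both components). [folklore] -/
theorem map_killQ_congr {R S : Type*} [CommRing R] [CommRing S] (f : R →+* S) (a b c : R) (z : R × R × R)
    (t₁ t₂ : R) (v w : R × R × R × R) (h₁ : f v.1 = f w.1) (h₂ : f v.2.1 = f w.2.1)
    (h₃ : f v.2.2.1 = f w.2.2.1) (h₄ : f v.2.2.2 = f w.2.2.2) :
    f (killQ a b c z t₁ t₂ v).1 = f (killQ a b c z t₁ t₂ w).1 ∧
      f (killQ a b c z t₁ t₂ v).2 = f (killQ a b c z t₁ t₂ w).2 := by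
  have hv := map_killQ f a b c z t₁ t₂ v
  have hw := map_killQ f a b c z t₁ t₂ w
  rw [h₁, h₂, h₃, h₄, ← hw] at hv
  exact ⟨congrArg Prod.fst hv, congrArg Prod.snd hv⟩

/-- **From a `p`-adic zero of the quadric pair to integer vectors primitive at `p` modulo `p^N`.** If
`killQ` (integer data `a b c`, `z`, `t₁ t₂`) has a zero `u ≠ 0` in `ℚ_[p]⁴`, then for every `N` there is an
integer vector `v`, not all of whose coordinates are divisible by `p`, with `p^N ∣ Q₁(v)` and `p^N ∣ Q₂(v)`:
rescale `u` to a primitive vector of `ℤ_p⁴` (`killQ` is homogeneous, `killQ_smul`), reduce modulo `p^{N+1}`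
and lift the residues to `ℤ`. [cite: CremonaAlgorithms1997, §3.6] -/
theorem exists_primitive_killQ_dvd_of_padic_zero (a b c : ℤ) (z : ℤ × ℤ × ℤ) (t₁ t₂ : ℤ)
    (u : ℚ_[p] × ℚ_[p] × ℚ_[p] × ℚ_[p]) (hu : u ≠ 0)
    (h0 : killQ (a : ℚ_[p]) (b : ℚ_[p]) (c : ℚ_[p]) ((z.1 : ℚ_[p]), (z.2.1 : ℚ_[p]), (z.2.2 : ℚ_[p]))
      (t₁ : ℚ_[p]) (t₂ : ℚ_[p]) u = 0) (N : ℕ) :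
    ∃ v : ℤ × ℤ × ℤ × ℤ, ¬ ((p : ℤ) ∣ v.1 ∧ (p : ℤ) ∣ v.2.1 ∧ (p : ℤ) ∣ v.2.2.1 ∧ (p : ℤ) ∣ v.2.2.2) ∧
      (p : ℤ) ^ N ∣ (killQ a b c z t₁ t₂ v).1 ∧ (p : ℤ) ^ N ∣ (killQ a b c z t₁ t₂ v).2 := by
  have hp : p.Prime := Fact.out
  -- the coordinates as a function
  set uf : Fin 4 → ℚ_[p] := ![u.1, u.2.1, u.2.2.1, u.2.2.2] with huf
  have hex : ∃ j, uf j ≠ 0 := by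
    by_contra hall
    push Not at hall
    apply hu
    have e0 := hall 0; have e1 := hall 1; have e2 := hall 2; have e3 := hall 3
    simp only [huf, Matrix.cons_val_zero, Matrix.cons_val_one, Matrix.cons_val_two, Matrix.tail_cons,
      Matrix.head_cons, Matrix.cons_val] at e0 e1 e2 e3
    exact Prod.ext e0 (Prod.ext e1 (Prod.ext e2 e3))
  obtain ⟨s, hs0, hle, j₀, hj₀⟩ := exists_scale_primitive uf hex
  -- the primitive `ℤ_p`-vector `w = s·u`
  let w : Fin 4 → ℤ_[p] := fun j => ⟨s * uf j, hle j⟩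
  have hw : killQ (a : ℤ_[p]) (b : ℤ_[p]) (c : ℤ_[p]) ((z.1 : ℤ_[p]), (z.2.1 : ℤ_[p]), (z.2.2 : ℤ_[p]))
      (t₁ : ℤ_[p]) (t₂ : ℤ_[p]) (w 0, w 1, w 2, w 3) = 0 := by
    have hmap := map_killQ (PadicInt.Coe.ringHom (p := p)) (a : ℤ_[p]) (b : ℤ_[p]) (c : ℤ_[p])
      ((z.1 : ℤ_[p]), (z.2.1 : ℤ_[p]), (z.2.2 : ℤ_[p])) (t₁ : ℤ_[p]) (t₂ : ℤ_[p]) (w 0, w 1, w 2, w 3)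
    have hsm := killQ_smul (a : ℚ_[p]) (b : ℚ_[p]) (c : ℚ_[p]) ((z.1 : ℚ_[p]), (z.2.1 : ℚ_[p]), (z.2.2 : ℚ_[p]))
      (t₁ : ℚ_[p]) (t₂ : ℚ_[p]) s u
    rw [h0] at hsm
    simp only [Prod.fst_zero, Prod.snd_zero, mul_zero] at hsm
    have hcoe : (((w 0 : ℤ_[p]) : ℚ_[p]), ((w 1 : ℤ_[p]) : ℚ_[p]), ((w 2 : ℤ_[p]) : ℚ_[p]),
        ((w 3 : ℤ_[p]) : ℚ_[p])) = (s * u.1, s * u.2.1, s * u.2.2.1, s * u.2.2.2) := by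
      simp only [w, huf, Matrix.cons_val_zero, Matrix.cons_val_one, Matrix.cons_val_two, Matrix.tail_cons,
        Matrix.head_cons, Matrix.cons_val]
    have hC : ∀ x : ℤ_[p], PadicInt.Coe.ringHom x = (x : ℚ_[p]) := fun x => rfl
    simp only [hC, PadicInt.coe_intCast] at hmap
    rw [hcoe, hsm] at hmap
    refine Prod.ext (PadicInt.coe_eq_zero.mp ?_) (PadicInt.coe_eq_zero.mp ?_)
    · exact congrArg Prod.fst hmap
    · exact congrArg Prod.snd hmap
  -- integer lifts of the residues mod `p^(N+1)`
  set M : ℕ := N + 1 with hM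
  haveI : NeZero (p ^ M) := ⟨pow_ne_zero _ hp.ne_zero⟩
  let vz : Fin 4 → ℤ := fun j => ((PadicInt.toZModPow M (w j)).val : ℤ)
  have hcong : ∀ j, PadicInt.toZModPow M ((vz j : ℤ) : ℤ_[p]) = PadicInt.toZModPow M (w j) := by
    intro j
    rw [map_intCast]
    simp only [vz, Int.cast_natCast, ZMod.natCast_zmod_val]
  refine ⟨(vz 0, vz 1, vz 2, vz 3), ?_, ?_, ?_⟩
  · -- primitivity: the coordinate `j₀` of `w` is a unit
    rintro ⟨d0, d1, d2, d3⟩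
    have hd : ∀ j, (p : ℤ) ∣ vz j := by
      intro j; fin_cases j
      · exact d0
      · exact d1
      · exact d2
      · exact d3
    have h1 : ‖((vz j₀ : ℤ) : ℤ_[p])‖ < 1 := (PadicInt.norm_int_lt_one_iff_dvd _).mpr (hd j₀)
    have h2 : ‖w j₀ - ((vz j₀ : ℤ) : ℤ_[p])‖ < 1 := by
      have hk : w j₀ - ((vz j₀ : ℤ) : ℤ_[p]) ∈ RingHom.ker (PadicInt.toZModPow M) := by
        rw [RingHom.mem_ker, map_sub, hcong, sub_self]
      rw [PadicInt.ker_toZModPow, ← PadicInt.norm_le_pow_iff_mem_span_pow] at hk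
      refine lt_of_le_of_lt hk ?_
      have hp1 : (1 : ℝ) < p := by exact_mod_cast hp.one_lt
      have : (p : ℝ) ^ (-(M : ℤ)) < (p : ℝ) ^ (0 : ℤ) := zpow_lt_zpow_right₀ hp1 (by omega)
      simpa using this
    have h3 : ‖w j₀‖ < 1 := by
      have := PadicInt.nonarchimedean (w j₀ - ((vz j₀ : ℤ) : ℤ_[p])) ((vz j₀ : ℤ) : ℤ_[p])
      rw [sub_add_cancel] at this
      exact lt_of_le_of_lt this (max_lt h2 h1)
    have h4 : ‖w j₀‖ = 1 := by rw [PadicInt.norm_def]; exact hj₀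
    linarith
  all_goals
    -- divisibility by `p^N` of both components (proved mod `p^(N+1)`)
    refine (pow_dvd_pow (p : ℤ) (show N ≤ M by omega)).trans ?_
    rw [← PadicInt.norm_int_le_pow_iff_dvd, PadicInt.norm_le_pow_iff_mem_span_pow,
      ← PadicInt.ker_toZModPow, RingHom.mem_ker]
  · have hm := congrArg Prod.fst (map_killQ (Int.castRingHom ℤ_[p]) a b c z t₁ t₂ (vz 0, vz 1, vz 2, vz 3))
    simp only [eq_intCast] at hm
    rw [hm, (map_killQ_congr (PadicInt.toZModPow M) (a : ℤ_[p]) (b : ℤ_[p]) (c : ℤ_[p])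
      ((z.1 : ℤ_[p]), (z.2.1 : ℤ_[p]), (z.2.2 : ℤ_[p])) (t₁ : ℤ_[p]) (t₂ : ℤ_[p])
      (((vz 0 : ℤ) : ℤ_[p]), ((vz 1 : ℤ) : ℤ_[p]), ((vz 2 : ℤ) : ℤ_[p]), ((vz 3 : ℤ) : ℤ_[p]))
      (w 0, w 1, w 2, w 3) (hcong 0) (hcong 1) (hcong 2) (hcong 3)).1, hw, Prod.fst_zero, map_zero]
  · have hm := congrArg Prod.snd (map_killQ (Int.castRingHom ℤ_[p]) a b c z t₁ t₂ (vz 0, vz 1, vz 2, vz 3))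
    simp only [eq_intCast] at hm
    rw [hm, (map_killQ_congr (PadicInt.toZModPow M) (a : ℤ_[p]) (b : ℤ_[p]) (c : ℤ_[p])
      ((z.1 : ℤ_[p]), (z.2.1 : ℤ_[p]), (z.2.2 : ℤ_[p])) (t₁ : ℤ_[p]) (t₂ : ℤ_[p])
      (((vz 0 : ℤ) : ℤ_[p]), ((vz 1 : ℤ) : ℤ_[p]), ((vz 2 : ℤ) : ℤ_[p]), ((vz 3 : ℤ) : ℤ_[p]))
      (w 0, w 1, w 2, w 3) (hcong 0) (hcong 1) (hcong 2) (hcong 3)).2, hw, Prod.snd_zero, map_zero]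

end Padic

/-! ## Step 2: the `α`, `α²` coordinates in `ℚ_[p] ⊗_ℚ K` -/

section Tensor

open Literature.NumberTheory.NumberFields Module Polynomial

variable {K : Type} [Field K] [NumberField K] {a b c : ℤ} {α : K} {p : ℕ} [Fact p.Prime]

/-- The element of `ℚ_[p] ⊗_ℚ K` with `ℚ_[p]`-coordinates `(q₀, q₁, q₂)` on the basis `1 ⊗ αⁱ`
(`Algebra.TensorProduct.basis` of `MonicCubic.basis`) is `q₀ + q₁·(1 ⊗ α) + q₂·(1 ⊗ α)²` read in the algebra.
[folklore] -/
theorem ev_tmul_eq_equivFun_symm (hirr : Irreducible (MonicCubic.polyQ a b c))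
    (hα : aeval α (MonicCubic.poly a b c) = 0) (h3 : finrank ℚ K = 3) (q₀ q₁ q₂ : ℚ_[p]) :
    ev ((1 : ℚ_[p]) ⊗ₜ[ℚ] α) (algebraMap ℚ_[p] (ℚ_[p] ⊗[ℚ] K) q₀, algebraMap ℚ_[p] (ℚ_[p] ⊗[ℚ] K) q₁,
        algebraMap ℚ_[p] (ℚ_[p] ⊗[ℚ] K) q₂) =
      (Algebra.TensorProduct.basis ℚ_[p] (MonicCubic.basis hirr hα h3)).equivFun.symm ![q₀, q₁, q₂] := by
  rw [Basis.equivFun_symm_apply, Fin.sum_univ_three]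
  simp only [ev, Matrix.cons_val_zero, Matrix.cons_val_one, Matrix.cons_val_two, Matrix.tail_cons,
    Matrix.head_cons, Algebra.TensorProduct.basis_apply, MonicCubic.basis_apply, Fin.val_zero, Fin.val_one,
    Fin.val_two, pow_zero, pow_one, Algebra.smul_def, Algebra.TensorProduct.tmul_pow, one_pow]
  rw [← Algebra.TensorProduct.one_def, mul_one]

/-- `1 ⊗ (u₀ + u₁α + u₂α²) = u₀ + u₁·(1 ⊗ α) + u₂·(1 ⊗ α)²` for integer coordinates. [folklore] -/
theorem one_tmul_evZ (u : ℤ × ℤ × ℤ) :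
    (1 : ℚ_[p]) ⊗ₜ[ℚ] evZ α u =
      ev ((1 : ℚ_[p]) ⊗ₜ[ℚ] α) (algebraMap ℚ_[p] (ℚ_[p] ⊗[ℚ] K) (u.1 : ℚ_[p]),
        algebraMap ℚ_[p] (ℚ_[p] ⊗[ℚ] K) (u.2.1 : ℚ_[p]), algebraMap ℚ_[p] (ℚ_[p] ⊗[ℚ] K) (u.2.2 : ℚ_[p])) := by
  have h := (Algebra.TensorProduct.includeRight (R := ℚ) (A := ℚ_[p]) (B := K)).map_add
  rw [← Algebra.TensorProduct.includeRight_apply (R := ℚ) (A := ℚ_[p]) (evZ α u)]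
  simp only [evZ, ev, map_add, map_mul, map_pow, map_intCast, Algebra.TensorProduct.includeRight_apply]

/-- **The `α`, `α²` coordinates of `(1 ⊗ z)·ρ² = x ⊗ 1 − 1 ⊗ θ`.** In the semi-local algebra `ℚ_[p] ⊗_ℚ K`
(`K = ℚ(α)` a cubic field, `F(α) = 0`, `[K : ℚ] = 3`, `F` irreducible), if `ρ` solves
`(1 ⊗ z)·ρ² = x ⊗ 1 − 1 ⊗ θ` with `x ∈ ℚ_[p]`, `z = z₀ + z₁α + z₂α²`, `θ = t₀ + t₁α + t₂α²` (integer
coordinates), then the `ℚ_[p]`-coordinates `(c₀, c₁, c₂)` of `ρ` on `1 ⊗ αⁱ` satisfy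
`killQ (c₀, c₁, c₂, 1) = 0` over `ℚ_[p]`: the `α` and `α²` coordinates of `z·ρ²` are `−t₁`, `−t₂`
(`ev_zsq`, uniqueness of coordinates on the basis `1 ⊗ αⁱ`). [cite: Cassels1991LecturesEllipticCurves, §15] -/
theorem killQ_eq_zero_of_tmul_sq (hirr : Irreducible (MonicCubic.polyQ a b c))
    (hα : aeval α (MonicCubic.poly a b c) = 0) (h3 : finrank ℚ K = 3)
    (z : ℤ × ℤ × ℤ) (t₀ t₁ t₂ : ℤ) (x : ℚ_[p]) (ρ : ℚ_[p] ⊗[ℚ] K)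
    (h : ((1 : ℚ_[p]) ⊗ₜ[ℚ] evZ α z) * ρ ^ 2 = x ⊗ₜ[ℚ] (1 : K) - (1 : ℚ_[p]) ⊗ₜ[ℚ] evZ α (t₀, t₁, t₂)) :
    ∃ c₀ c₁ c₂ : ℚ_[p], killQ (a : ℚ_[p]) (b : ℚ_[p]) (c : ℚ_[p])
      ((z.1 : ℚ_[p]), (z.2.1 : ℚ_[p]), (z.2.2 : ℚ_[p])) (t₁ : ℚ_[p]) (t₂ : ℚ_[p]) (c₀, c₁, c₂, 1) = 0 := by
  set B' := Algebra.TensorProduct.basis ℚ_[p] (MonicCubic.basis hirr hα h3) with hB'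
  set ι := algebraMap ℚ_[p] (ℚ_[p] ⊗[ℚ] K) with hι
  set αR : ℚ_[p] ⊗[ℚ] K := (1 : ℚ_[p]) ⊗ₜ[ℚ] α with hαR
  -- the cubic relation of `1 ⊗ α`
  have hαR3 : αR ^ 3 + (a : ℚ_[p] ⊗[ℚ] K) * αR ^ 2 + (b : ℚ_[p] ⊗[ℚ] K) * αR + (c : ℚ_[p] ⊗[ℚ] K) = 0 := by
    have h1 := congrArg (Algebra.TensorProduct.includeRight (R := ℚ) (A := ℚ_[p]) (B := K))
      (MonicCubic.theta_rel hα)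
    simp only [map_add, map_mul, map_pow, map_intCast, map_zero, Algebra.TensorProduct.includeRight_apply] at h1
    exact h1
  -- coordinates of `ρ`
  set cf : Fin 3 → ℚ_[p] := B'.equivFun ρ with hcf
  refine ⟨cf 0, cf 1, cf 2, ?_⟩
  have hρ : ρ = ev αR (ι (cf 0), ι (cf 1), ι (cf 2)) := by
    rw [hαR, hι, ev_tmul_eq_equivFun_symm hirr hα h3 (cf 0) (cf 1) (cf 2), ← hB']
    have e : ![cf 0, cf 1, cf 2] = cf := by
      funext i; fin_cases i <;> rfl
    rw [e, hcf, LinearEquiv.symm_apply_apply]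
  -- the two sides in `ev` form
  set q := zsq (a : ℚ_[p]) (b : ℚ_[p]) (c : ℚ_[p]) ((z.1 : ℚ_[p]), (z.2.1 : ℚ_[p]), (z.2.2 : ℚ_[p]))
    (cf 0, cf 1, cf 2) with hq
  have hmap := map_zsq ι (a : ℚ_[p]) (b : ℚ_[p]) (c : ℚ_[p]) ((z.1 : ℚ_[p]), (z.2.1 : ℚ_[p]), (z.2.2 : ℚ_[p]))
    (cf 0, cf 1, cf 2)
  rw [← hq] at hmap
  simp only [hι, map_intCast] at hmap
  have hL : ((1 : ℚ_[p]) ⊗ₜ[ℚ] evZ α z) * ρ ^ 2 = ev αR (ι q.1, ι q.2.1, ι q.2.2) := by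
    rw [one_tmul_evZ, hρ, ← ev_zsq hαR3, hι, hmap]
    simp only [map_intCast]
  have hR : x ⊗ₜ[ℚ] (1 : K) - (1 : ℚ_[p]) ⊗ₜ[ℚ] evZ α (t₀, t₁, t₂) =
      ev αR (ι (x - (t₀ : ℚ_[p])), ι (-(t₁ : ℚ_[p])), ι (-(t₂ : ℚ_[p]))) := by
    rw [one_tmul_evZ]
    have hx : x ⊗ₜ[ℚ] (1 : K) = ι x := by
      rw [hι, Algebra.TensorProduct.algebraMap_apply, Algebra.algebraMap_self, RingHom.id_apply]
    rw [hx]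
    simp only [ev, map_sub, map_neg, hαR]
    ring
  -- comparison of coordinates
  have hcoord : ![q.1, q.2.1, q.2.2] = ![x - (t₀ : ℚ_[p]), -(t₁ : ℚ_[p]), -(t₂ : ℚ_[p])] := by
    apply B'.equivFun.symm.injective
    rw [hB', ← ev_tmul_eq_equivFun_symm hirr hα h3 q.1 q.2.1 q.2.2,
      ← ev_tmul_eq_equivFun_symm hirr hα h3 (x - (t₀ : ℚ_[p])) (-(t₁ : ℚ_[p])) (-(t₂ : ℚ_[p])), ← hι, ← hαR,
      ← hL, ← hR, h]
  have e1 := congrFun hcoord 1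
  have e2 := congrFun hcoord 2
  simp only [Matrix.cons_val_one, Matrix.cons_val_two, Matrix.tail_cons, Matrix.head_cons, Matrix.cons_val] at e1 e2
  have hk : killQ (a : ℚ_[p]) (b : ℚ_[p]) (c : ℚ_[p]) ((z.1 : ℚ_[p]), (z.2.1 : ℚ_[p]), (z.2.2 : ℚ_[p]))
      (t₁ : ℚ_[p]) (t₂ : ℚ_[p]) (cf 0, cf 1, cf 2, 1) = (q.2.1 + t₁ * 1 ^ 2, q.2.2 + t₂ * 1 ^ 2) := by
    simp only [killQ, hq]
  rw [hk, e1, e2]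
  refine Prod.ext ?_ ?_ <;> simp

end Tensor

/-! ## Step 3: gluing per-place solutions along `ℚ_[p] ⊗_ℚ K ≅ ∏_{w ∣ p} K_w` -/

section Glue

open Literature.NumberTheory.NumberFields Literature.NumberTheory.AdelicBaseChange IsDedekindDomain NumberField
  Module Polynomial

variable {K : Type} [Field K] [NumberField K] {a b c : ℤ} {α : K} {p : ℕ} [Fact p.Prime]

/-- **Per-place square data glue to a solution in the semi-local algebra.** If at EVERY place `w ∣ p` of `K`
the equation `z·ρ_w² = x − θ` has a solution `ρ_w ∈ K_w` for one and the same `x ∈ ℚ_p` (`x : ℚ_{v_p}`,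
read in `K_w` through the structure map), then `(1 ⊗ z)·ρ² = x ⊗ 1 − 1 ⊗ θ` has a solution `ρ ∈ ℚ_[p] ⊗_ℚ K`
(with `x` read in `ℚ_[p]` through Mathlib's `ℚ_[p] ≅ ℚ_{v_p}`): `ρ = Ψ⁻¹((ρ_w)_w)` for the tree's
`Ψ : ℚ_[p] ⊗_ℚ K ≅ ∏_{w ∣ p} K_w` (`exists_padicTensorAlgEquiv`).
[cite: CasselsFrohlichANT1967, Ch. II §10 Theorem (10.2)] -/
theorem exists_tmul_sq_of_forall_extension (z t : ℤ × ℤ × ℤ)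
    (xv : ((Rat.HeightOneSpectrum.primesEquiv (R := 𝓞 ℚ)).symm ⟨p, Fact.out⟩).adicCompletion ℚ)
    (hw : ∀ w : ((Rat.HeightOneSpectrum.primesEquiv (R := 𝓞 ℚ)).symm ⟨p, Fact.out⟩).Extension (𝓞 K),
      ∃ ρw : w.1.adicCompletion K,
        algebraMap K (w.1.adicCompletion K) (evZ α z) * ρw ^ 2 =
          algebraMap (((Rat.HeightOneSpectrum.primesEquiv (R := 𝓞 ℚ)).symm ⟨p, Fact.out⟩).adicCompletion ℚ)
              (w.1.adicCompletion K) xv -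
            algebraMap K (w.1.adicCompletion K) (evZ α t)) :
    ∃ (x : ℚ_[p]) (ρ : ℚ_[p] ⊗[ℚ] K),
      ((1 : ℚ_[p]) ⊗ₜ[ℚ] evZ α z) * ρ ^ 2 = x ⊗ₜ[ℚ] (1 : K) - (1 : ℚ_[p]) ⊗ₜ[ℚ] evZ α t := by
  obtain ⟨Ψ, hΨ⟩ := exists_padicTensorAlgEquiv K p
  set e := Padic.adicCompletionEquiv (𝓞 ℚ) ⟨p, Fact.out⟩ with he
  choose ρw hρw using hw
  refine ⟨e.symm xv, Ψ.symm (fun w => ρw w), Ψ.injective ?_⟩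
  funext w
  rw [map_mul, map_pow, AlgEquiv.apply_symm_apply, map_sub, Pi.mul_apply, Pi.pow_apply, Pi.sub_apply,
    hΨ, hΨ, hΨ, map_one, map_one, mul_one, map_one, one_mul, mul_one, hρw w]
  congr 2
  exact (e.apply_symm_apply xv).symm

/-- **Local insolubility of the quadric pair is violated by per-place square data** (Steps 1–3): with
`K = ℚ(α)` a cubic field (`F(α) = 0`, `[K : ℚ] = 3`, `F` irreducible), `z`, `θ = t₀ + t₁α + t₂α²` with
integer coordinates, a prime `p` and `x ∈ ℚ_p`: if `z·ρ_w² = x − θ` is solvable in `K_w` at every `w ∣ p`,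
then for every `N` some integer vector primitive at `p` has `p^N ∣ Q₁, Q₂` — so no residue certificate
«no `p`-primitive `v` with `p^N ∣ killQ v`» can hold for `z`. [cite: Cassels1991LecturesEllipticCurves, §15]
[cite: CremonaAlgorithms1997, §3.6] -/
theorem exists_primitive_killQ_dvd_of_forall_extension (hirr : Irreducible (MonicCubic.polyQ a b c))
    (hα : aeval α (MonicCubic.poly a b c) = 0) (h3 : finrank ℚ K = 3)
    (z : ℤ × ℤ × ℤ) (t₀ t₁ t₂ : ℤ)
    (xv : ((Rat.HeightOneSpectrum.primesEquiv (R := 𝓞 ℚ)).symm ⟨p, Fact.out⟩).adicCompletion ℚ)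
    (hw : ∀ w : ((Rat.HeightOneSpectrum.primesEquiv (R := 𝓞 ℚ)).symm ⟨p, Fact.out⟩).Extension (𝓞 K),
      ∃ ρw : w.1.adicCompletion K,
        algebraMap K (w.1.adicCompletion K) (evZ α z) * ρw ^ 2 =
          algebraMap (((Rat.HeightOneSpectrum.primesEquiv (R := 𝓞 ℚ)).symm ⟨p, Fact.out⟩).adicCompletion ℚ)
              (w.1.adicCompletion K) xv -
            algebraMap K (w.1.adicCompletion K) (evZ α (t₀, t₁, t₂)))
    (N : ℕ) :
    ∃ v : ℤ × ℤ × ℤ × ℤ, ¬ ((p : ℤ) ∣ v.1 ∧ (p : ℤ) ∣ v.2.1 ∧ (p : ℤ) ∣ v.2.2.1 ∧ (p : ℤ) ∣ v.2.2.2) ∧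
      (p : ℤ) ^ N ∣ (killQ a b c z t₁ t₂ v).1 ∧ (p : ℤ) ^ N ∣ (killQ a b c z t₁ t₂ v).2 := by
  obtain ⟨x, ρ, h⟩ := exists_tmul_sq_of_forall_extension (α := α) z (t₀, t₁, t₂) xv hw
  obtain ⟨c₀, c₁, c₂, h0⟩ := killQ_eq_zero_of_tmul_sq hirr hα h3 z t₀ t₁ t₂ x ρ h
  refine exists_primitive_killQ_dvd_of_padic_zero a b c z t₁ t₂ (c₀, c₁, c₂, 1) ?_ h0 N
  intro h1
  have := congrArg (fun u : ℚ_[p] × ℚ_[p] × ℚ_[p] × ℚ_[p] => u.2.2.2) h1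
  simp at this

end Glue

end Summit.BirchSwinnertonDyer.BirchSwinnertonDyer.Theorems.ShaPrimaryTransferSelmerCubicKill

end
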